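import Summits.QuantumFields.YangMills.Theorems.Instrument.BesselCapRows
import Summits.QuantumFields.GaugeBoot.WilsonLoopLowerBounds
import Summits.QuantumFields.GaugeBoot.LimitPoints
import HarnessLib

/-!
# YM instrument cell — `SU(2)`, `D = 4`: the Bessel cap on rectangles at every base point and plane, and at
# infinite-volume LIMIT POINTS (`g_m(t) ≤ ρ^{2t}`, `m ≥ 2`; A-plan-11 v2 (B2) input)

Cell `ym-instrument` (HUMAN RULING D-0084 (2); director-ym R138; HOME `run/shared/lean/pub/ym-instrument/`), crew (a),
Lean typist seat `ym-instrument-boot-lean-1`. Question Q-A1, amendment A-plan-11 «BESSEL CAP», COROLLARY (support cap of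
the class-LIMIT strip families, boot-plan AMEND A-plan-10 §1 / v2 §1 (B2)); ladder consequence: the «LIMIT | cap» rows of
TABLE-A1 (IR `stmt-QuantumFields-19354`, THE NUMBER).

HONEST FRAMING (page 1 of every file of this cell): WHAT IS CERTIFIED HERE, AT WHICH `(G, D, L, β)`: `G = SU(2)`
(fundamental, standard Wilson action, tree coupling `β/2`), `D = 4`; (i) on EVERY torus `(ℤ/L)⁴` with `L ≥ max(R,T) + 3`,
at every base point and in every coordinate plane, `|⟨W_{R×T}⟩_β| ≤ ρ(β)^{2T}` for `R ≥ 2` and `≤ ρ(β)^{2R}` for `T ≥ 2`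
(`β ∈ {9/5, 2, 11/5, 12/5}` hypothesis-free; general `β > 0` under the point hypothesis `I₂(6β)/I₁(6β) ≤ ρ`); (ii) for EVERY
infinite-volume limit point `μ` of the torus Wilson states along ANY strictly increasing sequence of tori (even or odd),
the `ℤ⁴` Wilson-loop expectation obeys the same bounds: in the notation of `GaugeBoot/WilsonLoopLimitMonotone`,
`g_m(t) = ∫ W̄(t × m) dμ` satisfies `|g_m(t)| ≤ ρ^{2t}` for every `t` as soon as `m ≥ 2` — the moment bound behind
`supp μ_m ⊂ [0, ρ²]` (the Hausdorff-moment representation itself is NOT formalised here, as in `WilsonLoopLimitMonotone`).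
Fixed-coupling, `R`-independent perimeter-type bounds; NOT an area law, NOT a string tension, NOT a mass gap, no
continuum statement, no uniqueness of the limit claimed; nothing summit-bearing; no hypothesis left to the reader in the
per-`β` theorems.
-/

noncomputable section

namespace Summit.QuantumFields.YangMills.Theorems.Instrument

open MeasureTheory Filter Topology
open Summit.QuantumFields.GaugeBoot
open Literature.MathematicalPhysics.QuantumFieldTheory
open Literature.MathematicalPhysics.QuantumLattice (LGConfig IsInfiniteVolumeLimitAlong wilsonLoopObs rectWalk
  isCylinder_wilsonLoopObs continuous_wilsonLoopObs exists_abs_wilsonLoopObs_le normalisedCharacter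
  continuous_normalisedCharacter_comp)
open Literature.Analysis.FunctionSpaces (besselI)

/-! ## Torus: every base point, every plane, both orientations -/

/-- The based `R × T` loop at any `x` in any plane `i ≠ j` has the torus-averaged expectation (tree `OrbitAverages`). [folklore] -/
theorem wilsonExpectation_wilsonLoop_eq_wilsonLoopExpectation (L : ℕ) [NeZero L] (β : ℝ) (x : Site 4 L) {i j : Fin 4}
    (hij : i ≠ j) (R T : ℕ) :
    wilsonExpectation (suRep 2) (β / (2 : ℕ)) (wilsonLoop (suRep 2) x i j R T) = wilsonLoopExpectation 2 4 L β R T := by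
  rw [← wilsonExpectation_meanWilsonLoop_eq_wilsonLoop (suRep 2) (continuous_suRep 2) _ R T x hij]
  rfl

/-- **Torus cap, long second side**: `|⟨W_{R×T}(x; i, j)⟩_β| ≤ ρ^{2T}` for `R ≥ 2`, every torus `L` with `R + 3 ≤ L`,
`T + 3 ≤ L` (general `β > 0`, point hypothesis on `I₂/I₁(6β)`). [folklore] -/
theorem abs_wilsonExpectation_wilsonLoop_le_pow_snd {β ρ : ℝ} (hβ : 0 < β) (hρ0 : 0 ≤ ρ)
    (hρ : besselI 2 (6 * β) / besselI 1 (6 * β) ≤ ρ) {R T : ℕ} (hR : 2 ≤ R) (L : ℕ) [NeZero L] (hRL : R + 3 ≤ L)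
    (hTL : T + 3 ≤ L) (x : Site 4 L) {i j : Fin 4} (hij : i ≠ j) :
    |wilsonExpectation (suRep 2) (β / (2 : ℕ)) (wilsonLoop (suRep 2) x i j R T)| ≤ ρ ^ (2 * T) := by
  rw [wilsonExpectation_wilsonLoop_eq_wilsonLoopExpectation L β x hij]
  exact abs_wilsonLoop_le_pow_of_besselRatio_le hβ hρ0 hρ hR L hRL hTL

/-- **Torus cap, long first side**: `|⟨W_{R×T}(x; i, j)⟩_β| ≤ ρ^{2R}` for `T ≥ 2` (axis exchange, tree
`wilsonLoopExpectation_comm`). [folklore] -/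
theorem abs_wilsonExpectation_wilsonLoop_le_pow_fst {β ρ : ℝ} (hβ : 0 < β) (hρ0 : 0 ≤ ρ)
    (hρ : besselI 2 (6 * β) / besselI 1 (6 * β) ≤ ρ) {R T : ℕ} (hT : 2 ≤ T) (L : ℕ) [NeZero L] (hRL : R + 3 ≤ L)
    (hTL : T + 3 ≤ L) (x : Site 4 L) {i j : Fin 4} (hij : i ≠ j) :
    |wilsonExpectation (suRep 2) (β / (2 : ℕ)) (wilsonLoop (suRep 2) x i j R T)| ≤ ρ ^ (2 * R) := by
  rw [wilsonExpectation_wilsonLoop_eq_wilsonLoopExpectation L β x hij, wilsonLoopExpectation_comm (by norm_num) L β R T]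
  exact abs_wilsonLoop_le_pow_of_besselRatio_le hβ hρ0 hρ hT L hTL hRL

/-! ## Infinite-volume limit points along any increasing sequence of tori -/

/-- **LIMIT-POINT CAP (B2 input).** Let `μ` be an infinite-volume limit point of the `SU(2)`, `D = 4` torus Wilson states
at standard coupling `β > 0` along a strictly increasing sequence of tori `(ℤ/(L_k+1))⁴` (no parity assumption), and let
`I₂(6β)/I₁(6β) ≤ ρ`, `0 ≤ ρ`. Then for every base point `x ∈ ℤ⁴`, plane `i ≠ j` and `R ≥ 2`:
`|∫ W_{R×T}(x; i, j) dμ| ≤ ρ^{2T}` for EVERY `T` — in the notation of `WilsonLoopLimitMonotone`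
(`rectWalk x 0 j t m`: `t` along axis `0`, width `m`): `|g_m(t)| ≤ ρ^{2t}` whenever `m ≥ 2`. [folklore] -/
theorem abs_integral_limit_wilsonLoop_le_pow_snd {β ρ : ℝ} (hβ : 0 < β) (hρ0 : 0 ≤ ρ)
    (hρ : besselI 2 (6 * β) / besselI 1 (6 * β) ≤ ρ) {R T : ℕ} (hR : 2 ≤ R) {Lk : ℕ → ℕ} (hmono : StrictMono Lk)
    {μ : Measure (LGConfig 4 (SU 2))} (hμ : IsInfiniteVolumeLimitAlong (suRep 2) (β / (2 : ℕ)) Lk μ)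
    (x : Literature.Probability.LatticeModels.Site 4) {i j : Fin 4} (hij : i ≠ j) :
    |∫ U, wilsonLoopObs (normalisedCharacter 2 ∘ suRep 2) (rectWalk x i j R T) U ∂μ| ≤ ρ ^ (2 * T) := by
  have hχ := continuous_normalisedCharacter_comp (N := 2) (continuous_suRep 2)
  have hlim := hμ.2 _ _ (isCylinder_wilsonLoopObs (normalisedCharacter 2 ∘ suRep 2) (rectWalk x i j R T))
    (continuous_wilsonLoopObs hχ _) (exists_abs_wilsonLoopObs_le hχ _)
  simp only [Summit.QuantumFields.GaugeBoot.toTorusObservable_wilsonLoopObs_rectWalk] at hlim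
  have hev : ∀ᶠ k in atTop, |wilsonExpectation (suRep 2) (β / (2 : ℕ))
      (wilsonLoop (suRep 2) (Literature.Probability.LatticeModels.Torus.proj (Lk k + 1) x) i j R T)| ≤ ρ ^ (2 * T) :=
    Filter.eventually_atTop.2 ⟨R + T + 3, fun k hk => by
      have hk' : R + T + 3 ≤ Lk k + 1 := (hk.trans (hmono.id_le k)).trans (Nat.le_succ _)
      exact abs_wilsonExpectation_wilsonLoop_le_pow_snd hβ hρ0 hρ hR (Lk k + 1) (by omega) (by omega) _ hij⟩
  rw [abs_le]
  exact ⟨ge_of_tendsto hlim (hev.mono fun k hk => (abs_le.1 hk).1), le_of_tendsto hlim (hev.mono fun k hk => (abs_le.1 hk).2)⟩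

/-- **LIMIT-POINT CAP, long first side**: `|∫ W_{R×T}(x; i, j) dμ| ≤ ρ^{2R}` for `T ≥ 2`, every `R`. [folklore] -/
theorem abs_integral_limit_wilsonLoop_le_pow_fst {β ρ : ℝ} (hβ : 0 < β) (hρ0 : 0 ≤ ρ)
    (hρ : besselI 2 (6 * β) / besselI 1 (6 * β) ≤ ρ) {R T : ℕ} (hT : 2 ≤ T) {Lk : ℕ → ℕ} (hmono : StrictMono Lk)
    {μ : Measure (LGConfig 4 (SU 2))} (hμ : IsInfiniteVolumeLimitAlong (suRep 2) (β / (2 : ℕ)) Lk μ)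
    (x : Literature.Probability.LatticeModels.Site 4) {i j : Fin 4} (hij : i ≠ j) :
    |∫ U, wilsonLoopObs (normalisedCharacter 2 ∘ suRep 2) (rectWalk x i j R T) U ∂μ| ≤ ρ ^ (2 * R) := by
  have hχ := continuous_normalisedCharacter_comp (N := 2) (continuous_suRep 2)
  have hlim := hμ.2 _ _ (isCylinder_wilsonLoopObs (normalisedCharacter 2 ∘ suRep 2) (rectWalk x i j R T))
    (continuous_wilsonLoopObs hχ _) (exists_abs_wilsonLoopObs_le hχ _)
  simp only [Summit.QuantumFields.GaugeBoot.toTorusObservable_wilsonLoopObs_rectWalk] at hlim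
  have hev : ∀ᶠ k in atTop, |wilsonExpectation (suRep 2) (β / (2 : ℕ))
      (wilsonLoop (suRep 2) (Literature.Probability.LatticeModels.Torus.proj (Lk k + 1) x) i j R T)| ≤ ρ ^ (2 * R) :=
    Filter.eventually_atTop.2 ⟨R + T + 3, fun k hk => by
      have hk' : R + T + 3 ≤ Lk k + 1 := (hk.trans (hmono.id_le k)).trans (Nat.le_succ _)
      exact abs_wilsonExpectation_wilsonLoop_le_pow_fst hβ hρ0 hρ hT (Lk k + 1) (by omega) (by omega) _ hij⟩
  rw [abs_le]
  exact ⟨ge_of_tendsto hlim (hev.mono fun k hk => (abs_le.1 hk).1), le_of_tendsto hlim (hev.mono fun k hk => (abs_le.1 hk).2)⟩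

/-! ## The hypothesis-free limit rows at the Q-A1 couplings: `|g_m(t)| ≤ ρ(β)^{2t}`, `m ≥ 2`, all `t` -/

/-- **LIMIT cap at `β_std = 9/5`**: for every limit point along any increasing sequence of tori and every `t`,
`|∫ W̄(t × m) dμ| ≤ (2177/2500)^{2t}` when `m ≥ 2` (plane `(0, j)`, any `j ≠ 0`, any base point). [folklore] -/
theorem abs_limit_wilsonLoop_le_pow_b9o5 {Lk : ℕ → ℕ} (hmono : StrictMono Lk) {μ : Measure (LGConfig 4 (SU 2))}
    (hμ : IsInfiniteVolumeLimitAlong (suRep 2) ((9 / 5 : ℝ) / (2 : ℕ)) Lk μ) (x : Literature.Probability.LatticeModels.Site 4)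
    {j : Fin 4} (hj : j ≠ 0) {m : ℕ} (hm : 2 ≤ m) (t : ℕ) :
    |∫ U, wilsonLoopObs (normalisedCharacter 2 ∘ suRep 2) (rectWalk x 0 j t m) U ∂μ| ≤ (2177 / 2500 : ℝ) ^ (2 * t) :=
  abs_integral_limit_wilsonLoop_le_pow_fst (by norm_num) (by norm_num) besselRatio_b9o5_le hm hmono hμ x hj.symm

/-- **LIMIT cap at `β_std = 2`**: `|∫ W̄(t × m) dμ| ≤ (2207/2500)^{2t}` (`m ≥ 2`, all `t`). [folklore] -/
theorem abs_limit_wilsonLoop_le_pow_b2 {Lk : ℕ → ℕ} (hmono : StrictMono Lk) {μ : Measure (LGConfig 4 (SU 2))}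
    (hμ : IsInfiniteVolumeLimitAlong (suRep 2) ((2 : ℝ) / (2 : ℕ)) Lk μ) (x : Literature.Probability.LatticeModels.Site 4)
    {j : Fin 4} (hj : j ≠ 0) {m : ℕ} (hm : 2 ≤ m) (t : ℕ) :
    |∫ U, wilsonLoopObs (normalisedCharacter 2 ∘ suRep 2) (rectWalk x 0 j t m) U ∂μ| ≤ (2207 / 2500 : ℝ) ^ (2 * t) :=
  abs_integral_limit_wilsonLoop_le_pow_fst (by norm_num) (by norm_num) besselRatio_b2_le hm hmono hμ x hj.symm

/-- **LIMIT cap at `β_std = 11/5`**: `|∫ W̄(t × m) dμ| ≤ (558/625)^{2t}` (`m ≥ 2`, all `t`). [folklore] -/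
theorem abs_limit_wilsonLoop_le_pow_b11o5 {Lk : ℕ → ℕ} (hmono : StrictMono Lk) {μ : Measure (LGConfig 4 (SU 2))}
    (hμ : IsInfiniteVolumeLimitAlong (suRep 2) ((11 / 5 : ℝ) / (2 : ℕ)) Lk μ)
    (x : Literature.Probability.LatticeModels.Site 4) {j : Fin 4} (hj : j ≠ 0) {m : ℕ} (hm : 2 ≤ m) (t : ℕ) :
    |∫ U, wilsonLoopObs (normalisedCharacter 2 ∘ suRep 2) (rectWalk x 0 j t m) U ∂μ| ≤ (558 / 625 : ℝ) ^ (2 * t) :=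
  abs_integral_limit_wilsonLoop_le_pow_fst (by norm_num) (by norm_num) besselRatio_b11o5_le hm hmono hμ x hj.symm

/-- **LIMIT cap at `β_std = 12/5`**: `|∫ W̄(t × m) dμ| ≤ (9013/10000)^{2t}` (`m ≥ 2`, all `t`). [folklore] -/
theorem abs_limit_wilsonLoop_le_pow_b12o5 {Lk : ℕ → ℕ} (hmono : StrictMono Lk) {μ : Measure (LGConfig 4 (SU 2))}
    (hμ : IsInfiniteVolumeLimitAlong (suRep 2) ((12 / 5 : ℝ) / (2 : ℕ)) Lk μ)
    (x : Literature.Probability.LatticeModels.Site 4) {j : Fin 4} (hj : j ≠ 0) {m : ℕ} (hm : 2 ≤ m) (t : ℕ) :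
    |∫ U, wilsonLoopObs (normalisedCharacter 2 ∘ suRep 2) (rectWalk x 0 j t m) U ∂μ| ≤ (9013 / 10000 : ℝ) ^ (2 * t) :=
  abs_integral_limit_wilsonLoop_le_pow_fst (by norm_num) (by norm_num) besselRatio_b12o5_le hm hmono hμ x hj.symm

end Summit.QuantumFields.YangMills.Theorems.Instrument

end
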